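import Mathlib
import Summits.ResolutionOfSingularities.ResolutionOfSingularities.Theorems.HomologicalConductorNoZenoSurfaceCore
import Summits.ResolutionOfSingularities.ResolutionOfSingularities.Theorems.HomologicalConductorNoZenoCaInvertibleFourFacts
import HarnessLib

/-!
# Crux `NoZenoR` (stmt-ResolutionOfSingularities-19943) / kill test `SurfaceTermination` (stmt-16488):
# THE SURFACE CORE modulo FOUR prints (Görtz–Wedhorn 24.44 discharged, Lipman (12.1)(i) idle)

Route `ResolutionOfSingularities/HomologicalConductor` (cell decomp-res, hand leafhand-res-homologicalconduct-3 g1).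
OURS: AI-written, weaker than expert review; nothing here is a statement of the manuscript under review
(Hironaka 2017).  SUPPORT level, counted 0.  Def-free, no new named facts.

The surface core of record (`…NoZenoSurfaceCore`, p514642: the canonical normalised `ca`-tower resolves every SANDWICHED
surface germ along EVERY valuation) is stated modulo the registered six-fact bundle
`CJS2020General ∧ Lipman1969_1_2 ∧ Lipman1969_4_1 ∧ Lipman1969_12_1_i ∧ Lipman1969_12_1_ii ∧ GortzWedhorn2023_24_44_H2`.
Reading its proof: `Lipman1969_12_1_i` is never used, and `GortzWedhorn2023_24_44_H2` is used only through THEOREM A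
(`stub_caInvertibleMinRes`), which `…NoZenoCaInvertibleFourFacts` re-derives over the tree theorem
`NoZeno.gwH2ResolutionDim2_holds`.  Hence the SAME theorems modulo the FOUR-fact bundle

  `CJS2020General ∧ Lipman1969_1_2 ∧ Lipman1969_4_1 ∧ Lipman1969_12_1_ii`

(proofs verbatim those of p514642 with `caInvertibleMinRes_of_two_facts` for `stub_caInvertibleMinRes`):
`skyPrincipal_of_facts4`, `caPrincipalUpstairs_of_facts4`, **`sandwichedTermination_of_facts4`**,
`surfaceTermination_of_le_tower4`, `surfaceTermination_of_sandwiched4`; and `facts4_of_facts6` (the registered bundle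
implies the four-fact bundle, so nothing of record is weakened).  Exact remaining print debt of the sandwich core:
CJS 2020 Thm 1.2 (local uniformization of surfaces), Lipman (1.2) (rationality is resolution-independent),
Lipman (4.1) (minimal resolution), Lipman (12.1)(ii) (numerical criterion for global generation).
No crux, kill test or summit statement is proved here.
-/

-- single-problem summit: the doubled namespace component `ResolutionOfSingularities` is forced
set_option linter.dupNamespace false

noncomputable section

open CategoryTheory AlgebraicGeometry TopologicalSpace IsLocalRing
open Literature.RingTheory.CohomologyAnnihilator (cohomologyAnnihilator)
open Literature.AlgebraicGeometry.Resolution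
open Summit.ResolutionOfSingularities.ResolutionOfSingularities.Theses.HomologicalConductor
open Summit.ResolutionOfSingularities.ResolutionOfSingularities.Theorems.NoZeno.Birth

namespace Summit.ResolutionOfSingularities.ResolutionOfSingularities.Theorems.NoZeno.SandwichCluster.FourFacts

variable {k K : Type} [Field k] [Field K] [Algebra k K]

/-- **The registered six-fact bundle implies the four-fact bundle** (projection; recorded so that every consumer of
the six-fact theorems can switch to the four-fact twins without loss). [this work] -/
theorem facts4_of_facts6
    (hF : (Literature.AlgebraicGeometry.Resolution.CossartJannsenSaito2020General.{0} ∧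
      Literature.AlgebraicGeometry.Resolution.Lipman1969_1_2.{0} ∧
      Literature.AlgebraicGeometry.Resolution.Lipman1969_4_1.{0} ∧
      Literature.AlgebraicGeometry.Resolution.Lipman1969_12_1_i.{0} ∧
      Literature.AlgebraicGeometry.Resolution.Lipman1969_12_1_ii.{0} ∧
      Literature.AlgebraicGeometry.Morphisms.GortzWedhorn2023_24_44_H2.{0})) :
    (Literature.AlgebraicGeometry.Resolution.CossartJannsenSaito2020General.{0} ∧
      Literature.AlgebraicGeometry.Resolution.Lipman1969_1_2.{0} ∧
      Literature.AlgebraicGeometry.Resolution.Lipman1969_4_1.{0} ∧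
      Literature.AlgebraicGeometry.Resolution.Lipman1969_12_1_ii.{0}) :=
  ⟨hF.1, hF.2.1, hF.2.2.1, hF.2.2.2.2.1⟩

/-- **THEOREM A at sky points, modulo four prints** (twin of `skyPrincipal_of_facts`): for a singular sandwiched stage
`T_m` (`m ≥ m₀ + 1`) and a sky point `S` of `T_m`, the ideal `ca(T_m)·S` is principal — GE
(`stub_minResolutionExists`: CJS + Lipman (1.2), (4.1)), P1.3′ (`stub_skyPointLifts`: CJS), THEOREM A
(`caInvertibleMinRes_of_two_facts`: Lipman (1.2), (12.1)(ii)) and the bridge `isPrincipal_map_inclusion_of_lift`.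
[cite: Lipman1969, Thm. (4.1), (12.1)(ii)] -/
theorem skyPrincipal_of_facts4
    (hF : (Literature.AlgebraicGeometry.Resolution.CossartJannsenSaito2020General.{0} ∧
      Literature.AlgebraicGeometry.Resolution.Lipman1969_1_2.{0} ∧
      Literature.AlgebraicGeometry.Resolution.Lipman1969_4_1.{0} ∧
      Literature.AlgebraicGeometry.Resolution.Lipman1969_12_1_ii.{0}))
    (p : ℕ) (hp : p.Prime) (k K : Type) [Field k] [CharP k p] [Field K] [Algebra k K]
    (O : ValuationSubring K) (A R : Subalgebra k K) (m₀ : ℕ) (ctx : SandwichCtx O A R m₀)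
    (m : ℕ) (hm : m₀ + 1 ≤ m) (hsing : ¬ IsRegularLocalRing ↥(tower O A m))
    (S : Subalgebra k K) (hTS : tower O A m ≤ S) (hS : IsRegularLocalRing ↥S) (hS2 : ringKrullDim ↥S = 2)
    (hdom : ∀ t : K, t ∈ tower O A m → t⁻¹ ∈ S → t⁻¹ ∈ tower O A m)
    (hdomR : SubringDominates R.toSubring S.toSubring)
    (hsky : ∃ Q : Subring K, Relation.ReflTransGen IsQuadraticTransform R.toSubring Q ∧
      IsQuadraticTransform Q S.toSubring ∧ ¬ (tower O A m).toSubring ≤ Q) :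
    (Ideal.span {s : ↥S | (s : K) ∈ ca (tower O A m)}).IsPrincipal := by
  obtain ⟨hCJS, h12, h41, h121ii⟩ := hF
  obtain ⟨X, π, hπ⟩ := stub_minResolutionExists hCJS h12 h41 p hp k K O A R m₀ ctx m hm hsing
  obtain ⟨l, hl⟩ := stub_skyPointLifts hCJS p hp k K O A R m₀ ctx m hm hsing S hTS hS hS2 hdom hdomR hsky X π hπ
  haveI : IsLocalRing ↥S := inferInstance
  rw [span_ca_eq_map_inclusion (tower O A m) S hTS]
  refine isPrincipal_map_inclusion_of_lift (tower O A m) S hTS π l hl ?_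
  refine caInvertibleMinRes_of_two_facts h12 h121ii p hp k K O A R m₀ ctx m hm hsing X π hπ _ ?_
  -- the structure map at the lifted point is local: composed with `stalkClosedPointTo l` it is the local inclusion
  haveI hloc := isLocalHom_inclusion_of_dominates hTS hdom
  refine ⟨fun t ht => ?_⟩
  have hcomp := stalkClosedPointTo_germ_appTop π (Subalgebra.inclusion hTS).toRingHom l hl t
  have hu : IsUnit ((Subalgebra.inclusion hTS).toRingHom t) := by
    rw [← hcomp]
    exact ht.map _
  exact hloc.map_nonunit t hu

/-- **(Q_val) at every late sandwiched stage, modulo four prints** (twin of `caPrincipalUpstairs_of_facts`): for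
`m ≥ m₀ + 1` and EVERY regular local `S ⊇ T_m`, the ideal `ca(T_m)·S` is principal.
[cite: IyengarTakahashi2014, Thm. 5.4] [cite: Abhyankar1956Valuations, Thm. 3] [cite: Lipman1969, (12.1)(ii)] -/
theorem caPrincipalUpstairs_of_facts4
    (hF : (Literature.AlgebraicGeometry.Resolution.CossartJannsenSaito2020General.{0} ∧
      Literature.AlgebraicGeometry.Resolution.Lipman1969_1_2.{0} ∧
      Literature.AlgebraicGeometry.Resolution.Lipman1969_4_1.{0} ∧
      Literature.AlgebraicGeometry.Resolution.Lipman1969_12_1_ii.{0}))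
    (p : ℕ) (hp : p.Prime) (k K : Type) [Field k] [CharP k p] [Field K] [Algebra k K]
    (O : ValuationSubring K) (A R : Subalgebra k K) (m₀ : ℕ) (ctx : SandwichCtx O A R m₀)
    (m : ℕ) (hm : m₀ + 1 ≤ m) (S : Subalgebra k K) (hTS : tower O A m ≤ S) (hS : IsRegularLocalRing ↥S) :
    (Ideal.span {s : ↥S | (s : K) ∈ ca (tower O A m)}).IsPrincipal := by
  obtain ⟨hk, hA, hfr, hAO, -, hR, -, -, -, hRT⟩ := id ctx
  haveI := hS
  by_cases hreg : IsRegularLocalRing ↥(tower O A m)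
  · rw [span_ca_eq_top_of_isRegularLocalRing O A hk hA hfr hAO m hreg S hTS]
    exact ⟨⟨1, by simp⟩⟩
  refine caPrincipalUpstairs_of_skyPoints p hp k K O A R m₀ ctx m hm ?_ S hTS hS
  intro S' hTS' hS' hS2' hdom' hdomR' hsky'
  rcases hsky' with hR' | hQ
  · -- `S' = R`: then `R ≤ T_m ≤ S' = R` makes the singular stage the regular ring `R`
    exfalso
    have hTR : tower O A m ≤ R := hR' ▸ hTS'
    exact hreg (le_antisymm hTR (hRT m (by omega)) ▸ hR)
  · exact skyPrincipal_of_facts4 hF p hp k K O A R m₀ ctx m hm hreg S' hTS' hS' hS2' hdom' hdomR' hQ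

/-- **THE SURFACE CORE modulo FOUR prints** (twin of `sandwichedTermination_of_facts`): for every sandwich context
`SandwichCtx O A R m₀` — `k ⊆ O` ANY valuation ring of `K`, `A ⊆ O` finitely generated with `Frac A = K`, `tr.deg_k K = 2`,
`R ⊆ O` regular local with `Frac R = K`, `loc O R = R`, `R ≤ T_m` for `m ≥ m₀` — some stage `T_m` of the canonical
normalised `ca`-tower is a regular local ring.  Strong induction on the number of base points, exactly as p514642.
[cite: Spivakovsky1990, §II] [cite: Lipman1969, (12.1)(ii)] -/
theorem sandwichedTermination_of_facts4
    (hF : (Literature.AlgebraicGeometry.Resolution.CossartJannsenSaito2020General.{0} ∧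
      Literature.AlgebraicGeometry.Resolution.Lipman1969_1_2.{0} ∧
      Literature.AlgebraicGeometry.Resolution.Lipman1969_4_1.{0} ∧
      Literature.AlgebraicGeometry.Resolution.Lipman1969_12_1_ii.{0}))
    (p : ℕ) (hp : p.Prime) (k K : Type) [Field k] [CharP k p] [Field K] [Algebra k K]
    (O : ValuationSubring K) (A R : Subalgebra k K) (m₀ : ℕ) (ctx : SandwichCtx O A R m₀) :
    ∃ m : ℕ, IsRegularLocalRing ↥(tower O A m) := by
  suffices key : ∀ n : ℕ, ∀ m : ℕ, m₀ + 1 ≤ m → (basePts R (tower O A m)).ncard = n →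
      ∃ m' : ℕ, IsRegularLocalRing ↥(tower O A m') from key _ (m₀ + 1) le_rfl rfl
  intro n
  induction n using Nat.strong_induction_on with
  | _ n ih =>
    intro m hm hn
    rcases (basePts R (tower O A m)).eq_empty_or_nonempty with hempty | hne
    · exact ⟨m, stub_regularOfBasePtsEmpty p hp k K O A R m₀ ctx m hm hempty⟩
    · by_cases hreg : IsRegularLocalRing ↥(tower O A (m + 1))
      · exact ⟨m + 1, hreg⟩
      · have hfin : (basePts R (tower O A m)).Finite := stub_basePtsFinite p hp k K O A R m₀ ctx m hm
        have hss : basePts R (tower O A (m + 1)) ⊂ basePts R (tower O A m) :=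
          stub_basePtsStrictAnti p hp k K O A R m₀ ctx m hm
            (caPrincipalUpstairs_of_facts4 hF p hp k K O A R m₀ ctx m hm) hne hreg
        have hlt : (basePts R (tower O A (m + 1))).ncard < n := by
          rw [← hn]; exact Set.ncard_lt_ncard hss hfin
        exact ih _ hlt (m + 1) (by omega) rfl

/-- **`SurfaceTermination` once the tower is sandwiched at some stage, modulo four prints** (twin of
`surfaceTermination_of_le_tower`). [cite: Spivakovsky1990, §II] [cite: Matsumura1987, Thm. 5.6] -/
theorem surfaceTermination_of_le_tower4
    (hF : (Literature.AlgebraicGeometry.Resolution.CossartJannsenSaito2020General.{0} ∧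
      Literature.AlgebraicGeometry.Resolution.Lipman1969_1_2.{0} ∧
      Literature.AlgebraicGeometry.Resolution.Lipman1969_4_1.{0} ∧
      Literature.AlgebraicGeometry.Resolution.Lipman1969_12_1_ii.{0}))
    (p : ℕ) (hp : p.Prime) (k K : Type) [Field k] [CharP k p] [Field K] [Algebra k K]
    (O : ValuationSubring K) (A : Subalgebra k K) (hk : ∀ c : k, algebraMap k K c ∈ O) (hA : A.FG)
    (hfr : IsFractionRing ↥A K) (hAO : A.toSubring ≤ O.toSubring) (hdimA : ringKrullDim ↥A = 2)
    (R : Subalgebra k K) (hR : IsRegularLocalRing ↥R) (hRfr : IsFractionRing ↥R K)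
    (hRO : R.toSubring ≤ O.toSubring) (hlocR : loc O R = R) (m₀ : ℕ) (hRT : R ≤ tower O A m₀) :
    ∃ m : ℕ, IsRegularLocalRing ↥(tower O A m) := by
  haveI := hfr
  have htr : Algebra.trdeg k K = 2 :=
    Theorems.HomologicalConductor.PersistenceSurfaceTowerDim.trdeg_eq_of_ringKrullDim_eq A hA (d := 2)
      (by exact_mod_cast hdimA)
  -- the tower is increasing, so `R ≤ T_m` for all `m ≥ m₀`
  have hmono : ∀ m : ℕ, m₀ ≤ m → R ≤ tower O A m := by
    intro m hm
    induction hm with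
    | refl => exact hRT
    | step _ ih =>
      refine ih.trans fun y hy => ?_
      rw [tower_succ]
      exact Theorems.SyzygyFlattening.self_le_locAt O _
        (Theorems.SyzygyFlattening.self_le_nrm _ (Algebra.subset_adjoin (Or.inl hy)))
  have ctx : SandwichCtx O A R m₀ := ⟨hk, hA, hfr, hAO, htr, hR, hRfr, hRO, hlocR, hmono⟩
  exact sandwichedTermination_of_facts4 hF p hp k K O A R m₀ ctx

/-- **The kill test `SurfaceTermination` for SANDWICHED STARTING GERMS, modulo four prints** (twin of
`surfaceTermination_of_sandwiched`): if `T₀ = loc O A` contains a regular local `k`-subalgebra `R ⊆ O` with `Frac R = K`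
and `loc O R = R`, the canonical normalised `ca`-tower of the surface datum reaches a regular stage along EVERY valuation.
[cite: Spivakovsky1990, §II] [cite: Lipman1969, (12.1)(ii)] -/
theorem surfaceTermination_of_sandwiched4
    (hF : (Literature.AlgebraicGeometry.Resolution.CossartJannsenSaito2020General.{0} ∧
      Literature.AlgebraicGeometry.Resolution.Lipman1969_1_2.{0} ∧
      Literature.AlgebraicGeometry.Resolution.Lipman1969_4_1.{0} ∧
      Literature.AlgebraicGeometry.Resolution.Lipman1969_12_1_ii.{0}))
    (p : ℕ) (hp : p.Prime) (k K : Type) [Field k] [CharP k p] [Field K] [Algebra k K]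
    (O : ValuationSubring K) (A : Subalgebra k K) (hk : ∀ c : k, algebraMap k K c ∈ O) (hA : A.FG)
    (hfr : IsFractionRing ↥A K) (hAO : A.toSubring ≤ O.toSubring) (hdimA : ringKrullDim ↥A = 2)
    (R : Subalgebra k K) (hR : IsRegularLocalRing ↥R) (hRfr : IsFractionRing ↥R K)
    (hRO : R.toSubring ≤ O.toSubring) (hlocR : loc O R = R) (hRA : R ≤ loc O A) :
    ∃ m : ℕ, IsRegularLocalRing ↥(tower O A m) :=
  surfaceTermination_of_le_tower4 hF p hp k K O A hk hA hfr hAO hdimA R hR hRfr hRO hlocR 0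
    (by rw [tower_zero]; exact hRA)

end Summit.ResolutionOfSingularities.ResolutionOfSingularities.Theorems.NoZeno.SandwichCluster.FourFacts

end
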